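import Literature.Analysis.Fourier.SelbergMajorantsFourier
import Literature.NumberTheory.LFunctions.DirichletPolynomialOffDiagonalMVT
import HarnessLib

/-!
# The mean value theorem for Dirichlet series with a free bandwidth (Goldston–Montgomery 1987, Lemma 6)

Topic `Literature/NumberTheory/LFunctions` (namespace `Literature.NumberTheory.LFunctions`, proof objects in
`SelbergMVT`). Proofs only: no definitions, no named facts. Companion of
`DirichletPolynomialOffDiagonalMVT.lean`: there the off-diagonal terms of `∫_0^T |∑ a_n n^{-it}|² dt` are kept
with the kernel `2/|log n − log m|` for ALL pairs `m ≠ n`; here, following Goldston–Montgomery, only the pairs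
with `|log n − log m| < 2πΔ` survive, at the price `Δ⁻¹ ∑ |a_n|²`, for a free parameter `Δ > 0`:

* `SelbergMVT.abs_meanSquare_sub_le_nearDiag` — for complex `a_n`, `T ≥ 0`, `Δ > 0`,
  `|∫_0^T |∑_{n=1}^{N} a_n n^{-it}|² dt − T ∑_{n=1}^{N} |a_n|²|
     ≤ Δ⁻¹ ∑_{n=1}^{N} |a_n|² + (T + Δ⁻¹) ∑_{m ≠ n, |log n − log m| < 2πΔ} |a_m||a_n|`;
* `SelbergMVT.abs_meanSquare_tsum_sub_le_nearDiag` — the same for an absolutely convergent Dirichlet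
  series `∑ c_n n^{-it}` (`c 0 = 0`, `∑ |c_n| < ∞`), the near-diagonal sums of all truncations being `≤ B`.

This is Goldston–Montgomery 1987, Lemma 6 ("Let `S(t) = ∑_{μ∈M} c(μ)e(μt)` … If `δ ≥ T⁻¹` then
`∫_0^T |S(t)|² dt = (T + O(δ⁻¹)) ∑_μ |c(μ)|² + O(T ∑_{0<|μ−ν|<δ} |c(μ)c(ν)|)`"), with the printed proof:
"Selberg (see Vaaler) has constructed functions `F₋(t)` and `F₊(t)` such that `F₋ ≤ χ_{[0,T]} ≤ F₊`,
`F̂±(x) = 0` for `|x| ≥ δ`, and `∫ F± = T ± δ⁻¹`. Hence `∫_0^T |S|² ≤ ∫ |S|² F₊ = ∑_{μ,ν} c(μ) c̄(ν) F̂₊(ν − μ)`.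
The terms `μ = ν` contribute `(T + δ⁻¹) ∑ |c(μ)|²`. Since `|F̂₊| ≤ ∫ |F₊| = T + δ⁻¹`, the terms `μ ≠ ν`
contribute at most `(T + δ⁻¹) ∑_{0<|μ−ν|<δ} |c(μ)c(ν)|`. This gives an upper bound, and a corresponding lower
bound is derived similarly using `F₋`" (for `F₋` one uses `∫ |F₋| ≤ T + δ⁻¹`). Selberg's functions are the
tree's `Literature.Analysis.Fourier.selbergMajorantReal` / `selbergMinorantReal` (`SelbergMajorants.lean`,
`SelbergMajorantsFourier.lean`: `indicator_le_selbergMajorantReal`, `selbergMinorantReal_le_indicator_Icc`,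
`integral_selbergMajorantReal`, `integral_selbergMinorantReal`, `fourier_selbergMajorant_eq_zero`,
`fourier_selbergMinorant_eq_zero`). We keep the explicit constants (no `δ ≥ T⁻¹` needed): the printed
`O(T ∑_{near})` is `(T + Δ⁻¹) ∑_{near}` here. In Mathlib's normalisation `𝓕 f(ξ) = ∫ f(t) e^{−2πiξt} dt` the phase
`n^{-it} = e(−t log n/(2π))` has frequency `−log n/(2π)`, so "`|μ − ν| < δ`" with `δ = Δ` reads
`|log n − log m| < 2πΔ`.

The kernel computation is recorded for general real frequencies (`SelbergMVT.integral_kernel_mul_norm_sq_eq`,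
`SelbergMVT.abs_integral_kernel_mul_norm_sq_sub_le`), so that other Dirichlet-type sums can use it.

## References

* [GoldstonMontgomery1987] D. A. Goldston, H. L. Montgomery, *Pair correlation of zeros and primes in short
  intervals*, in: Analytic Number Theory and Diophantine Problems (Stillwater 1984), Progr. Math. 70, Birkhäuser
  (1987), 183–203, §3, Lemma 6 (statement and proof quoted above, read on the scanned page).
* A. Languasco, A. Perelli, A. Zaccagnini, *An extended pair-correlation conjecture and primes in short
  intervals*, Trans. AMS (2017), arXiv:1311.0597, Lemma 5 (restates GM87 Lemma 6).
* [Vaaler1985] J. D. Vaaler, *Some extremal functions in Fourier analysis*, Bull. AMS 12 (1985), Thm. 8.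
-/

noncomputable section

open Finset Real MeasureTheory Complex Filter
open scoped ComplexConjugate FourierTransform Topology

namespace Literature.NumberTheory.LFunctions

namespace SelbergMVT

open Literature.Analysis.Fourier

/-! ## Trigonometric polynomials with real frequencies against an integrable kernel -/

variable {ι : Type*}

/-- The phase `e^{iωt}` as a function of `t`. [folklore] -/
private theorem continuous_phase (ω : ℝ) : Continuous fun t : ℝ ↦ Complex.exp (((ω * t : ℝ) : ℂ) * I) := by
  fun_prop

/-- `|e^{iωt}| = 1`. [folklore] -/
private theorem norm_phase (ω t : ℝ) : ‖Complex.exp (((ω * t : ℝ) : ℂ) * I)‖ = 1 :=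
  Complex.norm_exp_ofReal_mul_I _

/-- A trigonometric polynomial `P(t) = ∑_{r∈s} c_r e^{iω_r t}` is continuous. [folklore] -/
private theorem continuous_trigPoly (s : Finset ι) (c : ι → ℂ) (ω : ι → ℝ) :
    Continuous fun t : ℝ ↦ ∑ r ∈ s, c r * Complex.exp (((ω r * t : ℝ) : ℂ) * I) :=
  continuous_finsetSum _ fun _ _ ↦ continuous_const.mul (continuous_phase _)

/-- `|P(t)| ≤ ∑ |c_r|`. [folklore] -/
private theorem norm_trigPoly_le (s : Finset ι) (c : ι → ℂ) (ω : ι → ℝ) (t : ℝ) :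
    ‖∑ r ∈ s, c r * Complex.exp (((ω r * t : ℝ) : ℂ) * I)‖ ≤ ∑ r ∈ s, ‖c r‖ := by
  refine (norm_sum_le _ _).trans (Finset.sum_le_sum fun r _ ↦ ?_)
  rw [norm_mul, norm_phase, mul_one]

/-- `∫ K(t) e^{iut} dt = 𝓕K(−u/(2π))` for an integrable real kernel `K` (Mathlib's normalisation
`𝓕 f(ξ) = ∫ f(t) e^{−2πitξ} dt`). [folklore] -/
private theorem integral_kernel_mul_phase_eq_fourier (K : ℝ → ℝ) (u : ℝ) :
    ∫ t : ℝ, (K t : ℂ) * Complex.exp (((u * t : ℝ) : ℂ) * I) =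
      𝓕 (fun t : ℝ ↦ (K t : ℂ)) (-u / (2 * π)) := by
  rw [Real.fourier_real_eq_integral_exp_smul]
  refine integral_congr_ae (Eventually.of_forall fun t ↦ ?_)
  simp only [smul_eq_mul]
  rw [mul_comm (K t : ℂ)]
  congr 2
  have hπ : (π : ℝ) ≠ 0 := Real.pi_ne_zero
  push_cast
  field_simp

/-- **The kernel identity**: for an integrable real kernel `K`,
`∫ K(t) |∑_{r∈s} c_r e^{iω_r t}|² dt = ∑_{r,r'∈s} c_r c̄_{r'} 𝓕K((ω_{r'} − ω_r)/(2π))`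
(multiply out and integrate termwise). [cite: GoldstonMontgomery1987, §3 Lemma 6 (proof)] -/
theorem integral_kernel_mul_norm_sq_eq (s : Finset ι) (c : ι → ℂ) (ω : ι → ℝ) {K : ℝ → ℝ}
    (hK : Integrable K) :
    ∫ t : ℝ, (K t : ℂ) * ((‖∑ r ∈ s, c r * Complex.exp (((ω r * t : ℝ) : ℂ) * I)‖ ^ 2 : ℝ) : ℂ) =
      ∑ r ∈ s, ∑ r' ∈ s, c r * conj (c r') * 𝓕 (fun t : ℝ ↦ (K t : ℂ)) ((ω r' - ω r) / (2 * π)) := by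
  classical
  have hKc : Integrable fun t : ℝ ↦ (K t : ℂ) := hK.ofReal
  -- expand the square
  have hexp : ∀ t : ℝ,
      (K t : ℂ) * ((‖∑ r ∈ s, c r * Complex.exp (((ω r * t : ℝ) : ℂ) * I)‖ ^ 2 : ℝ) : ℂ) =
        ∑ r ∈ s, ∑ r' ∈ s,
          c r * conj (c r') * ((K t : ℂ) * Complex.exp ((((ω r - ω r') * t : ℝ) : ℂ) * I)) := by
    intro t
    rw [ofReal_norm_sq_sum_eq, Finset.mul_sum]
    refine Finset.sum_congr rfl fun r _ ↦ ?_
    rw [Finset.mul_sum]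
    refine Finset.sum_congr rfl fun r' _ ↦ ?_
    rw [map_mul, conj_exp_ofReal_mul_I]
    have : Complex.exp (((ω r * t : ℝ) : ℂ) * I) * Complex.exp ((((-(ω r' * t) : ℝ)) : ℂ) * I) =
        Complex.exp ((((ω r - ω r') * t : ℝ) : ℂ) * I) := by
      rw [← Complex.exp_add]; congr 1; push_cast; ring
    calc (K t : ℂ) * (c r * Complex.exp (((ω r * t : ℝ) : ℂ) * I) *
          (conj (c r') * Complex.exp (((-(ω r' * t) : ℝ) : ℂ) * I)))
        = c r * conj (c r') * ((K t : ℂ) * (Complex.exp (((ω r * t : ℝ) : ℂ) * I) *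
            Complex.exp (((-(ω r' * t) : ℝ) : ℂ) * I))) := by ring
      _ = _ := by rw [this]
  -- each term is integrable
  have hint : ∀ r r' : ι, Integrable fun t : ℝ ↦
      c r * conj (c r') * ((K t : ℂ) * Complex.exp ((((ω r - ω r') * t : ℝ) : ℂ) * I)) := by
    intro r r'
    refine Integrable.const_mul ?_ _
    have h := hKc.bdd_mul (c := 1) (continuous_phase (ω r - ω r')).aestronglyMeasurable
      (Eventually.of_forall fun t ↦ (norm_phase _ _).le)
    refine h.congr (Eventually.of_forall fun t ↦ ?_)
    simp only [mul_comm]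
  simp_rw [hexp]
  rw [integral_finsetSum _ fun r _ ↦ integrable_finsetSum _ fun r' _ ↦ hint r r']
  refine Finset.sum_congr rfl fun r _ ↦ ?_
  rw [integral_finsetSum _ fun r' _ ↦ hint r r']
  refine Finset.sum_congr rfl fun r' _ ↦ ?_
  rw [integral_const_mul, integral_kernel_mul_phase_eq_fourier]
  congr 2
  ring

/-- `|𝓕K(ξ)| ≤ ∫ |K|`. [folklore] -/
private theorem norm_fourier_ofReal_le (K : ℝ → ℝ) (ξ : ℝ) :
    ‖𝓕 (fun t : ℝ ↦ (K t : ℂ)) ξ‖ ≤ ∫ t : ℝ, |K t| := by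
  rw [Real.fourier_real_eq_integral_exp_smul]
  refine (norm_integral_le_integral_norm _).trans (le_of_eq ?_)
  refine integral_congr_ae (Eventually.of_forall fun t ↦ ?_)
  simp only [norm_smul, Complex.norm_exp_ofReal_mul_I, one_mul, Complex.norm_real, Real.norm_eq_abs]

/-- `𝓕K(0) = ∫ K`. [folklore] -/
private theorem fourier_ofReal_zero (K : ℝ → ℝ) : 𝓕 (fun t : ℝ ↦ (K t : ℂ)) 0 = ((∫ t : ℝ, K t : ℝ) : ℂ) := by
  rw [Real.fourier_real_eq_integral_exp_smul]
  simp only [mul_zero, Complex.ofReal_zero, zero_mul, Complex.exp_zero, one_smul]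
  exact integral_ofReal

/-- **The kernel bound**: if `K` is an integrable real kernel whose Fourier transform vanishes for
`|ξ| ≥ Δ`, then
`|∫ K |P|² − (∫ K) ∑_r |c_r|²| ≤ (∫ |K|) ∑_{r ≠ r', |ω_r − ω_{r'}| < 2πΔ} |c_r||c_{r'}|`
for `P(t) = ∑_{r∈s} c_r e^{iω_r t}` (the pairs with `|ω_r − ω_{r'}| ≥ 2πΔ` do not contribute).
[cite: GoldstonMontgomery1987, §3 Lemma 6 (proof)] -/
theorem abs_integral_kernel_mul_norm_sq_sub_le [DecidableEq ι] (s : Finset ι) (c : ι → ℂ) (ω : ι → ℝ)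
    {K : ℝ → ℝ} (hK : Integrable K) {Δ : ℝ}
    (hKΔ : ∀ ξ : ℝ, Δ ≤ |ξ| → 𝓕 (fun t : ℝ ↦ (K t : ℂ)) ξ = 0) :
    |(∫ t : ℝ, K t * ‖∑ r ∈ s, c r * Complex.exp (((ω r * t : ℝ) : ℂ) * I)‖ ^ 2) -
        (∫ t : ℝ, K t) * ∑ r ∈ s, ‖c r‖ ^ 2| ≤
      (∫ t : ℝ, |K t|) * ∑ r ∈ s, ∑ r' ∈ (s.erase r).filter (fun r' ↦ |ω r - ω r'| < 2 * π * Δ),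
        ‖c r‖ * ‖c r'‖ := by
  classical
  set P : ℝ → ℂ := fun t ↦ ∑ r ∈ s, c r * Complex.exp (((ω r * t : ℝ) : ℂ) * I) with hP
  set G : ℝ → ℂ := fun ξ ↦ 𝓕 (fun t : ℝ ↦ (K t : ℂ)) ξ with hG
  -- the real integral as a complex one
  have hreal : (((∫ t : ℝ, K t * ‖P t‖ ^ 2) : ℝ) : ℂ) = ∫ t : ℝ, (K t : ℂ) * ((‖P t‖ ^ 2 : ℝ) : ℂ) := by
    rw [← integral_complex_ofReal]; push_cast; rfl
  have hid := integral_kernel_mul_norm_sq_eq s c ω hK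
  -- split the double sum: diagonal / near / far
  have hsplit : ∀ r ∈ s, ∑ r' ∈ s, c r * conj (c r') * G ((ω r' - ω r) / (2 * π)) =
      c r * conj (c r) * G 0 +
        ∑ r' ∈ (s.erase r).filter (fun r' ↦ |ω r - ω r'| < 2 * π * Δ),
          c r * conj (c r') * G ((ω r' - ω r) / (2 * π)) := by
    intro r hr
    rw [← Finset.add_sum_erase s _ hr, sub_self, zero_div]
    congr 1
    rw [← Finset.sum_filter_add_sum_filter_not (s.erase r) (fun r' ↦ |ω r - ω r'| < 2 * π * Δ)]
    conv_rhs => rw [← add_zero (∑ r' ∈ (s.erase r).filter (fun r' ↦ |ω r - ω r'| < 2 * π * Δ),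
      c r * conj (c r') * G ((ω r' - ω r) / (2 * π)))]
    congr 1
    refine Finset.sum_eq_zero fun r' hr' ↦ ?_
    rw [Finset.mem_filter, not_lt] at hr'
    have hfar : Δ ≤ |(ω r' - ω r) / (2 * π)| := by
      rw [abs_div, abs_of_pos (by positivity : (0 : ℝ) < 2 * π), le_div_iff₀ (by positivity),
        abs_sub_comm]
      linarith [hr'.2]
    have hz : G ((ω r' - ω r) / (2 * π)) = 0 := hKΔ _ hfar
    rw [hz, mul_zero]
  have hsum : ∫ t : ℝ, (K t : ℂ) * ((‖P t‖ ^ 2 : ℝ) : ℂ) =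
      (∑ r ∈ s, c r * conj (c r)) * G 0 +
        ∑ r ∈ s, ∑ r' ∈ (s.erase r).filter (fun r' ↦ |ω r - ω r'| < 2 * π * Δ),
          c r * conj (c r') * G ((ω r' - ω r) / (2 * π)) := by
    rw [hP, hid, Finset.sum_congr rfl hsplit, Finset.sum_add_distrib, Finset.sum_mul]
  -- the diagonal
  have hdiag : (∑ r ∈ s, c r * conj (c r)) * G 0 = ((((∫ t : ℝ, K t) * ∑ r ∈ s, ‖c r‖ ^ 2 : ℝ)) : ℂ) := by
    have hG0 : G 0 = ((∫ t : ℝ, K t : ℝ) : ℂ) := fourier_ofReal_zero K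
    rw [hG0]
    push_cast
    rw [mul_comm]
    congr 1
    refine Finset.sum_congr rfl fun r _ ↦ ?_
    rw [Complex.mul_conj, Complex.normSq_eq_norm_sq]; push_cast; ring
  -- the near terms
  have hnear : ‖∑ r ∈ s, ∑ r' ∈ (s.erase r).filter (fun r' ↦ |ω r - ω r'| < 2 * π * Δ),
      c r * conj (c r') * G ((ω r' - ω r) / (2 * π))‖ ≤
      (∫ t : ℝ, |K t|) * ∑ r ∈ s, ∑ r' ∈ (s.erase r).filter (fun r' ↦ |ω r - ω r'| < 2 * π * Δ),
        ‖c r‖ * ‖c r'‖ := by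
    rw [Finset.mul_sum]
    refine (norm_sum_le _ _).trans (Finset.sum_le_sum fun r _ ↦ ?_)
    rw [Finset.mul_sum]
    refine (norm_sum_le _ _).trans (Finset.sum_le_sum fun r' _ ↦ ?_)
    rw [norm_mul, norm_mul, Complex.norm_conj]
    have h1 := norm_fourier_ofReal_le K ((ω r' - ω r) / (2 * π))
    have h0 : 0 ≤ ‖c r‖ * ‖c r'‖ := by positivity
    calc ‖c r‖ * ‖c r'‖ * ‖G ((ω r' - ω r) / (2 * π))‖ ≤ ‖c r‖ * ‖c r'‖ * ∫ t : ℝ, |K t| :=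
          mul_le_mul_of_nonneg_left h1 h0
      _ = (∫ t : ℝ, |K t|) * (‖c r‖ * ‖c r'‖) := by ring
  -- conclude
  have key : (((∫ t : ℝ, K t * ‖P t‖ ^ 2) - (∫ t : ℝ, K t) * ∑ r ∈ s, ‖c r‖ ^ 2 : ℝ) : ℂ) =
      ∑ r ∈ s, ∑ r' ∈ (s.erase r).filter (fun r' ↦ |ω r - ω r'| < 2 * π * Δ),
        c r * conj (c r') * G ((ω r' - ω r) / (2 * π)) := by
    push_cast
    rw [hreal, hsum, hdiag]
    push_cast
    ring
  rw [← Real.norm_eq_abs, ← Complex.norm_real, key]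
  exact hnear

/-! ## The interval `[0, T]`: Selberg's majorant and minorant -/

/-- `∫ |F₋| ≤ T + 1/Δ` for Selberg's minorant of `[0, T]`: pointwise `|F₋| ≤ 2·𝟙_{[0,T]} − F₋`
(as `F₋ ≤ 𝟙_{[0,T]}`), and `∫ F₋ = T − 1/Δ`. [cite: GoldstonMontgomery1987, §3 Lemma 6 (proof)] -/
theorem integral_abs_selbergMinorantReal_le {Δ T : ℝ} (hΔ : 0 < Δ) (hT : 0 ≤ T) :
    ∫ t : ℝ, |selbergMinorantReal Δ 0 T t| ≤ T + 1 / Δ := by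
  have hle : ∀ t : ℝ, |selbergMinorantReal Δ 0 T t| ≤
      2 * (Set.Icc 0 T).indicator (fun _ ↦ (1 : ℝ)) t - selbergMinorantReal Δ 0 T t := by
    intro t
    have h1 := selbergMinorantReal_le_indicator_Icc hΔ 0 T t
    have h2 : 0 ≤ (Set.Icc 0 T).indicator (fun _ ↦ (1 : ℝ)) t :=
      Set.indicator_nonneg (fun _ _ ↦ zero_le_one) t
    rcases le_or_gt 0 (selbergMinorantReal Δ 0 T t) with h | h
    · rw [abs_of_nonneg h]; linarith
    · rw [abs_of_neg h]; linarith
  have hi1 : Integrable fun t : ℝ ↦ 2 * (Set.Icc 0 T).indicator (fun _ ↦ (1 : ℝ)) t -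
      selbergMinorantReal Δ 0 T t :=
    ((integrable_indicator_Icc 0 T).const_mul 2).sub (integrable_selbergMinorantReal hΔ hT)
  calc ∫ t : ℝ, |selbergMinorantReal Δ 0 T t|
      ≤ ∫ t : ℝ, (2 * (Set.Icc 0 T).indicator (fun _ ↦ (1 : ℝ)) t - selbergMinorantReal Δ 0 T t) :=
        integral_mono (integrable_selbergMinorantReal hΔ hT).abs hi1 hle
    _ = 2 * T - (T - 1 / Δ) := by
        rw [integral_sub ((integrable_indicator_Icc 0 T).const_mul 2) (integrable_selbergMinorantReal hΔ hT),
          integral_const_mul, integral_indicator_Icc hT, integral_selbergMinorantReal hΔ hT]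
        ring
    _ = T + 1 / Δ := by ring

/-- `∫ |F₊| = T + 1/Δ` for Selberg's majorant of `[0, T]` (`F₊ ≥ 0`). [cite: GoldstonMontgomery1987, §3 Lemma 6 (proof)] -/
theorem integral_abs_selbergMajorantReal_eq {Δ T : ℝ} (hΔ : 0 < Δ) (hT : 0 ≤ T) :
    ∫ t : ℝ, |selbergMajorantReal Δ 0 T t| = T + 1 / Δ := by
  rw [integral_congr_ae (Eventually.of_forall fun t ↦ abs_of_nonneg (selbergMajorantReal_nonneg hΔ hT t)),
    integral_selbergMajorantReal hΔ hT]
  ring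

/-- `𝓕F₊(ξ) = 0` for `|ξ| ≥ Δ`, for the real-valued majorant of `[0,T]` coerced to `ℂ`.
[cite: Vaaler1985, Thm. 8] -/
theorem fourier_selbergMajorantReal_eq_zero {Δ T : ℝ} (hΔ : 0 < Δ) (hT : 0 ≤ T) (ξ : ℝ)
    (hξ : Δ ≤ |ξ|) : 𝓕 (fun t : ℝ ↦ (selbergMajorantReal Δ 0 T t : ℂ)) ξ = 0 := by
  have h : (fun t : ℝ ↦ (selbergMajorantReal Δ 0 T t : ℂ)) = fun t : ℝ ↦ selbergMajorant Δ 0 T t := by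
    funext t; rw [selbergMajorant_ofReal]
  rw [h]; exact fourier_selbergMajorant_eq_zero hΔ hT hξ

/-- `𝓕F₋(ξ) = 0` for `|ξ| ≥ Δ`, for the real-valued minorant of `[0,T]` coerced to `ℂ`.
[cite: Vaaler1985, Thm. 8] -/
theorem fourier_selbergMinorantReal_eq_zero {Δ T : ℝ} (hΔ : 0 < Δ) (hT : 0 ≤ T) (ξ : ℝ)
    (hξ : Δ ≤ |ξ|) : 𝓕 (fun t : ℝ ↦ (selbergMinorantReal Δ 0 T t : ℂ)) ξ = 0 := by
  have h : (fun t : ℝ ↦ (selbergMinorantReal Δ 0 T t : ℂ)) = fun t : ℝ ↦ selbergMinorant Δ 0 T t := by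
    funext t; rw [selbergMinorant_ofReal]
  rw [h]; exact fourier_selbergMinorant_eq_zero hΔ hT hξ

/-- **Goldston–Montgomery 1987, Lemma 6, for trigonometric polynomials with real frequencies**: for
`P(t) = ∑_{r∈s} c_r e^{iω_r t}`, `T ≥ 0` and `Δ > 0`,
`|∫_0^T |P|² − T ∑ |c_r|²| ≤ Δ⁻¹ ∑ |c_r|² + (T + Δ⁻¹) ∑_{r ≠ r', |ω_r − ω_{r'}| < 2πΔ} |c_r||c_{r'}|`.
Proof as printed: `F₋ ≤ 𝟙_{[0,T]} ≤ F₊` with Selberg's functions of bandwidth `Δ`, the kernel bound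
`abs_integral_kernel_mul_norm_sq_sub_le` for `F₊` and `F₋`, `∫ F± = T ± Δ⁻¹`, `∫ |F±| ≤ T + Δ⁻¹`.
[cite: GoldstonMontgomery1987, §3 Lemma 6] -/
theorem abs_meanSquare_trigPoly_sub_le [DecidableEq ι] (s : Finset ι) (c : ι → ℂ) (ω : ι → ℝ)
    {T Δ : ℝ} (hT : 0 ≤ T) (hΔ : 0 < Δ) :
    |(∫ t in (0 : ℝ)..T, ‖∑ r ∈ s, c r * Complex.exp (((ω r * t : ℝ) : ℂ) * I)‖ ^ 2) -
        T * ∑ r ∈ s, ‖c r‖ ^ 2| ≤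
      1 / Δ * ∑ r ∈ s, ‖c r‖ ^ 2 +
        (T + 1 / Δ) * ∑ r ∈ s, ∑ r' ∈ (s.erase r).filter (fun r' ↦ |ω r - ω r'| < 2 * π * Δ),
          ‖c r‖ * ‖c r'‖ := by
  classical
  set P : ℝ → ℂ := fun t ↦ ∑ r ∈ s, c r * Complex.exp (((ω r * t : ℝ) : ℂ) * I) with hP
  set Sq : ℝ := ∑ r ∈ s, ‖c r‖ ^ 2 with hSq
  set Nr : ℝ := ∑ r ∈ s, ∑ r' ∈ (s.erase r).filter (fun r' ↦ |ω r - ω r'| < 2 * π * Δ),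
    ‖c r‖ * ‖c r'‖ with hNr
  set Fp : ℝ → ℝ := selbergMajorantReal Δ 0 T with hFp
  set Fm : ℝ → ℝ := selbergMinorantReal Δ 0 T with hFm
  have hPc : Continuous P := continuous_trigPoly s c ω
  have hP2c : Continuous fun t ↦ ‖P t‖ ^ 2 := by fun_prop
  set A : ℝ := ∑ r ∈ s, ‖c r‖ with hA
  have hPb : ∀ t, ‖P t‖ ^ 2 ≤ A ^ 2 := fun t ↦
    pow_le_pow_left₀ (norm_nonneg _) (norm_trigPoly_le s c ω t) 2
  have hP2b : ∀ t, ‖(‖P t‖ ^ 2 : ℝ)‖ ≤ A ^ 2 := fun t ↦ by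
    rw [Real.norm_of_nonneg (by positivity)]; exact hPb t
  -- integrability of `F± · |P|²`
  have hFpi : Integrable Fp := integrable_selbergMajorantReal hΔ hT
  have hFmi : Integrable Fm := integrable_selbergMinorantReal hΔ hT
  have hprod : ∀ {F : ℝ → ℝ}, Integrable F → Integrable fun t ↦ F t * ‖P t‖ ^ 2 := by
    intro F hF
    have h := hF.bdd_mul (c := A ^ 2) hP2c.aestronglyMeasurable (Eventually.of_forall hP2b)
    exact h.congr (Eventually.of_forall fun t ↦ by simp only [mul_comm])
  -- `∫_0^T |P|²` as an integral of the indicator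
  have hind : (∫ t in (0 : ℝ)..T, ‖P t‖ ^ 2) =
      ∫ t : ℝ, (Set.Icc 0 T).indicator (fun _ ↦ (1 : ℝ)) t * ‖P t‖ ^ 2 := by
    rw [intervalIntegral.integral_of_le hT, ← integral_Icc_eq_integral_Ioc,
      ← integral_indicator measurableSet_Icc]
    refine integral_congr_ae (Eventually.of_forall fun t ↦ ?_)
    by_cases ht : t ∈ Set.Icc 0 T
    · simp [Set.indicator_of_mem ht]
    · simp [Set.indicator_of_notMem ht]
  have hindi : Integrable fun t : ℝ ↦ (Set.Icc 0 T).indicator (fun _ ↦ (1 : ℝ)) t * ‖P t‖ ^ 2 :=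
    hprod (integrable_indicator_Icc 0 T)
  -- upper bound via `F₊`
  have hup : (∫ t in (0 : ℝ)..T, ‖P t‖ ^ 2) ≤ ∫ t : ℝ, Fp t * ‖P t‖ ^ 2 := by
    rw [hind]
    refine integral_mono hindi (hprod hFpi) fun t ↦ ?_
    exact mul_le_mul_of_nonneg_right (indicator_le_selbergMajorantReal hΔ hT t) (by positivity)
  -- lower bound via `F₋`
  have hlo : (∫ t : ℝ, Fm t * ‖P t‖ ^ 2) ≤ ∫ t in (0 : ℝ)..T, ‖P t‖ ^ 2 := by
    rw [hind]
    refine integral_mono (hprod hFmi) hindi fun t ↦ ?_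
    exact mul_le_mul_of_nonneg_right (selbergMinorantReal_le_indicator_Icc hΔ 0 T t) (by positivity)
  -- the kernel bounds
  have hkp := abs_integral_kernel_mul_norm_sq_sub_le s c ω hFpi (fourier_selbergMajorantReal_eq_zero hΔ hT)
  have hkm := abs_integral_kernel_mul_norm_sq_sub_le s c ω hFmi (fourier_selbergMinorantReal_eq_zero hΔ hT)
  rw [integral_selbergMajorantReal hΔ hT, integral_abs_selbergMajorantReal_eq hΔ hT, sub_zero] at hkp
  rw [integral_selbergMinorantReal hΔ hT, sub_zero] at hkm
  have habsm := integral_abs_selbergMinorantReal_le hΔ hT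
  have hSq0 : 0 ≤ Sq := Finset.sum_nonneg fun r _ ↦ by positivity
  have hNr0 : 0 ≤ Nr := Finset.sum_nonneg fun r _ ↦ Finset.sum_nonneg fun r' _ ↦ by positivity
  have hkp' := (abs_le.1 hkp).2
  have hkm' := (abs_le.1 hkm).1
  have hm2 : (∫ t : ℝ, |Fm t|) * Nr ≤ (T + 1 / Δ) * Nr := mul_le_mul_of_nonneg_right habsm hNr0
  rw [abs_le]
  constructor
  · nlinarith
  · nlinarith

/-! ## Dirichlet polynomials and Dirichlet series -/

/-- **Goldston–Montgomery 1987, Lemma 6, for Dirichlet polynomials**: for complex `a_n`, `T ≥ 0` and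
`Δ > 0`,
`|∫_0^T |∑_{n=1}^{N} a_n n^{-it}|² dt − T ∑_{n=1}^{N} |a_n|²|
   ≤ Δ⁻¹ ∑_{n=1}^{N} |a_n|² + (T + Δ⁻¹) ∑_{1 ≤ m ≠ n ≤ N, |log n − log m| < 2πΔ} |a_m||a_n|`
(the frequencies of `n^{-it} = e^{−it log n}` are `ω_n = −log n`). [cite: GoldstonMontgomery1987, §3 Lemma 6] -/
theorem abs_meanSquare_sub_le_nearDiag (a : ℕ → ℂ) (N : ℕ) {T Δ : ℝ} (hT : 0 ≤ T) (hΔ : 0 < Δ) :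
    |(∫ t in (0 : ℝ)..T, ‖∑ n ∈ Finset.Icc 1 N, a n * (n : ℂ) ^ (-((t : ℂ) * I))‖ ^ 2) -
        T * ∑ n ∈ Finset.Icc 1 N, ‖a n‖ ^ 2| ≤
      1 / Δ * ∑ n ∈ Finset.Icc 1 N, ‖a n‖ ^ 2 +
        (T + 1 / Δ) * ∑ m ∈ Finset.Icc 1 N,
          ∑ n ∈ ((Finset.Icc 1 N).erase m).filter (fun n : ℕ ↦ |Real.log n - Real.log m| < 2 * π * Δ),
            ‖a m‖ * ‖a n‖ := by
  classical
  have h := abs_meanSquare_trigPoly_sub_le (Finset.Icc 1 N) a (fun n : ℕ ↦ -Real.log n) hT hΔ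
  have hphase : ∀ t : ℝ, ∑ n ∈ Finset.Icc 1 N, a n * (n : ℂ) ^ (-((t : ℂ) * I)) =
      ∑ n ∈ Finset.Icc 1 N, a n * Complex.exp ((((-Real.log n) * t : ℝ) : ℂ) * I) := by
    intro t
    refine Finset.sum_congr rfl fun n hn ↦ ?_
    rw [Finset.mem_Icc] at hn
    rw [natCast_cpow_neg_mul_I (by omega)]
    congr 2; push_cast; ring
  simp_rw [hphase]
  have hfilt : ∀ m : ℕ, ((Finset.Icc 1 N).erase m).filter
      (fun n : ℕ ↦ |(-Real.log (m : ℝ)) - (-Real.log (n : ℝ))| < 2 * π * Δ) =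
      ((Finset.Icc 1 N).erase m).filter (fun n : ℕ ↦ |Real.log (n : ℝ) - Real.log (m : ℝ)| < 2 * π * Δ) :=
    fun m ↦ Finset.filter_congr (fun n _ ↦ by rw [neg_sub_neg])
  simp only [hfilt] at h
  exact h

/-- **Goldston–Montgomery 1987, Lemma 6, for absolutely convergent Dirichlet series**: for `c : ℕ → ℂ`
with `c 0 = 0` and `∑ |c_n| < ∞`, `T ≥ 0`, `Δ > 0`, if the near-diagonal sums
`∑_{1 ≤ m ≠ n ≤ N, |log n − log m| < 2πΔ} |c_m||c_n|` of all truncations are `≤ B`, then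
`|∫_0^T |∑_n c_n n^{-it}|² dt − T ∑_n |c_n|²| ≤ Δ⁻¹ ∑_n |c_n|² + (T + Δ⁻¹) B`
(the truncations converge boundedly; dominated convergence). [cite: GoldstonMontgomery1987, §3 Lemma 6] -/
theorem abs_meanSquare_tsum_sub_le_nearDiag {c : ℕ → ℂ} (hc : Summable fun n ↦ ‖c n‖) (h0 : c 0 = 0)
    {T Δ : ℝ} (hT : 0 ≤ T) (hΔ : 0 < Δ) {B : ℝ}
    (hB : ∀ N : ℕ, ∑ m ∈ Finset.Icc 1 N,
        ∑ n ∈ ((Finset.Icc 1 N).erase m).filter (fun n : ℕ ↦ |Real.log n - Real.log m| < 2 * π * Δ),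
          ‖c m‖ * ‖c n‖ ≤ B) :
    |(∫ t in (0 : ℝ)..T, ‖∑' n, c n * (n : ℂ) ^ (-((t : ℂ) * I))‖ ^ 2) - T * ∑' n, ‖c n‖ ^ 2| ≤
      1 / Δ * ∑' n, ‖c n‖ ^ 2 + (T + 1 / Δ) * B := by
  classical
  set u : ℕ → ℝ → ℂ := fun n t ↦ c n * (n : ℂ) ^ (-((t : ℂ) * I)) with hu
  -- termwise norm bound
  have hun : ∀ n t, ‖u n t‖ ≤ ‖c n‖ := by
    intro n t
    rcases Nat.eq_zero_or_pos n with rfl | hn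
    · simp [hu, h0]
    · simp only [hu, norm_mul]
      rw [natCast_cpow_neg_mul_I hn.ne', Complex.norm_exp_ofReal_mul_I, mul_one]
  have hu0 : ∀ t, u 0 t = 0 := fun t ↦ by simp [hu, h0]
  have hsum : ∀ t, Summable fun n ↦ u n t := fun t ↦
    Summable.of_norm_bounded hc (hun · t)
  set A : ℝ := ∑' n, ‖c n‖ with hA
  -- partial sums converge
  have hlim : ∀ t, Tendsto (fun N : ℕ ↦ ∑ n ∈ Finset.Icc 1 N, u n t) atTop (𝓝 (∑' n, u n t)) := by
    intro t
    have h1 := (hsum t).hasSum.tendsto_sum_nat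
    have h2 := h1.comp (tendsto_add_atTop_nat 1)
    refine h2.congr fun N ↦ ?_
    simp only [Function.comp]
    exact DirichletMVT.sum_range_succ_eq_sum_Icc (fun n ↦ u n t) (hu0 t) N
  -- uniform bound on partial sums
  have hbdN : ∀ N t, ‖∑ n ∈ Finset.Icc 1 N, u n t‖ ≤ A := by
    intro N t
    refine (norm_sum_le _ _).trans ?_
    refine (Finset.sum_le_sum fun n _ ↦ hun n t).trans ?_
    exact hc.sum_le_tsum _ (fun n _ ↦ norm_nonneg _)
  -- squares are summable, and their partial sums converge (monotonically)
  have hsqsum : Summable fun n ↦ ‖c n‖ ^ 2 := by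
    refine Summable.of_nonneg_of_le (fun n ↦ sq_nonneg _) (fun n ↦ ?_) (hc.mul_left A)
    have h1 : ‖c n‖ ≤ A := hc.le_tsum n (fun m _ ↦ norm_nonneg _)
    calc ‖c n‖ ^ 2 = ‖c n‖ * ‖c n‖ := sq _
      _ ≤ A * ‖c n‖ := mul_le_mul_of_nonneg_right h1 (norm_nonneg _)
  have hlim2 : Tendsto (fun N : ℕ ↦ ∑ n ∈ Finset.Icc 1 N, ‖c n‖ ^ 2) atTop
      (𝓝 (∑' n, ‖c n‖ ^ 2)) := by
    have h1 := hsqsum.hasSum.tendsto_sum_nat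
    have h2 := h1.comp (tendsto_add_atTop_nat 1)
    refine h2.congr fun N ↦ ?_
    simp only [Function.comp]
    exact DirichletMVT.sum_range_succ_eq_sum_Icc (fun n ↦ ‖c n‖ ^ 2) (by simp [h0]) N
  have hsqle : ∀ N, ∑ n ∈ Finset.Icc 1 N, ‖c n‖ ^ 2 ≤ ∑' n, ‖c n‖ ^ 2 := fun N ↦
    hsqsum.sum_le_tsum _ (fun n _ ↦ sq_nonneg _)
  -- the finite bound, uniformly in `N`
  have hfin : ∀ N, |(∫ t in (0 : ℝ)..T, ‖∑ n ∈ Finset.Icc 1 N, u n t‖ ^ 2) -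
      T * ∑ n ∈ Finset.Icc 1 N, ‖c n‖ ^ 2| ≤ 1 / Δ * ∑' n, ‖c n‖ ^ 2 + (T + 1 / Δ) * B := by
    intro N
    refine (abs_meanSquare_sub_le_nearDiag c N hT hΔ).trans ?_
    have hTΔ : 0 ≤ T + 1 / Δ := by positivity
    gcongr
    · exact hsqle N
    · exact hB N
  -- dominated convergence on `[0, T]`
  have hcontN : ∀ N, Continuous fun t : ℝ ↦ ‖∑ n ∈ Finset.Icc 1 N, u n t‖ ^ 2 := by
    intro N
    refine (continuous_norm.comp (continuous_finsetSum _ fun n hn ↦ continuous_const.mul ?_)).pow 2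
    rw [Finset.mem_Icc] at hn
    have : (fun t : ℝ ↦ (n : ℂ) ^ (-((t : ℂ) * I))) =
        fun t : ℝ ↦ Complex.exp ((-(t * Real.log n) : ℝ) * I) := by
      funext t; exact natCast_cpow_neg_mul_I (by omega) t
    rw [this]; fun_prop
  have htend : Tendsto (fun N : ℕ ↦ ∫ t in (0 : ℝ)..T, ‖∑ n ∈ Finset.Icc 1 N, u n t‖ ^ 2)
      atTop (𝓝 (∫ t in (0 : ℝ)..T, ‖∑' n, u n t‖ ^ 2)) := by
    simp_rw [intervalIntegral.integral_of_le hT]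
    refine tendsto_integral_of_dominated_convergence (fun _ ↦ A ^ 2) (fun N ↦ ?_) ?_ (fun N ↦ ?_) ?_
    · exact (hcontN N).aestronglyMeasurable
    · exact integrableOn_const (by simp)
    · refine Filter.Eventually.of_forall fun t ↦ ?_
      rw [Real.norm_of_nonneg (by positivity)]
      exact pow_le_pow_left₀ (norm_nonneg _) (hbdN N t) 2
    · refine Filter.Eventually.of_forall fun t ↦ ?_
      exact ((continuous_norm.tendsto _).comp (hlim t)).pow 2
  have hD : Tendsto (fun N : ℕ ↦ |(∫ t in (0 : ℝ)..T, ‖∑ n ∈ Finset.Icc 1 N, u n t‖ ^ 2) -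
      T * ∑ n ∈ Finset.Icc 1 N, ‖c n‖ ^ 2|) atTop
      (𝓝 |(∫ t in (0 : ℝ)..T, ‖∑' n, u n t‖ ^ 2) - T * ∑' n, ‖c n‖ ^ 2|) :=
    (htend.sub (hlim2.const_mul T)).abs
  exact le_of_tendsto' hD hfin

end SelbergMVT

end Literature.NumberTheory.LFunctions

end
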